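/-
Copyright (c) 2026 the pub-hodgecm-mathlib formalisation cell (harness21).  Prover seat hodgecm-mathlib-F0P2-p06 (g12), 2026-09-01.  Road «S3-ram» seeding wave (LEAD F0P3a-plan (g12)
T11-41; owner F0P3a-p06 (g15)); «O8c-ram» FILE 2: the per-vertex-type core + STUB B′ of A-p16 (g31)'s P-1-ram skeleton v2 e79877dd9dcb92c5 (`stub_typeOne_HSideBasis_ram`).
-/
import Literature.NumberTheory.Rogawski1990.RankOneStableDepthExpansionRamifiedHead          -- ★ A-p19 (g25) T6-1r HEAD and its whole closure: EDGE ∕ VERTEX pairs, adapter, R-0c partner, A-p01 eigenframe, signed normal forms, vertex cover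
import Literature.NumberTheory.Rogawski1990.DepthZeroTransferHValuesTypeOne                    -- ★ p846285 (inert O8c): `sq_redMat_sub_one_eq_zero_of_isLocalStablyConjH`, eigenframe-from-root bookkeeping
import Literature.NumberTheory.Rogawski1990.DepthZeroKappaTransferTypeOne                       -- ★ p846528 (the INERT clause: tokens; `isUnit_two_integer_iff_valued_eq_one`) + ★ `…Counts` `valuation_sub_one_lt_one_of_isRoot_charpoly_of_residuallyUnipotent`
import Literature.NumberTheory.Rogawski1990.UnitaryVertexStabilizerSpanCM                      -- ★ `setOf_residuallyUnipotent_endoEmbLocal_mem_nhds_one`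
import Literature.NumberTheory.Rogawski1990.FinExplicitTransferFactorResiduallyRegular          -- ★ `charpoly_map_endoEmbLocal_apply`
import Literature.NumberTheory.Rogawski1990.UnitFundamentalLemmaInertLeviClause                 -- ★ `isLocalGRegular_conj_iff`, `cmLocalIntegralLevel_one_eq_top_of_smul_eq`
import Literature.NumberTheory.Rogawski1990.LocalTransferCompactSideJunctionCM                  -- ★ `isLocalGRegular_of_isLocalStablyConjH`
import Literature.NumberTheory.Automorphic.UnitaryTwoRamifiedTreeStabilizers                     -- ★ `coe_mem_map_conj_glDiagonal_iff_forall_v_le_one` (`K♯` by entries)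
import Literature.NumberTheory.Automorphic.UnitaryTwoResiduallyUnipotentTrivialRamified           -- ★ p846905 (this seat): evidence (b)
import Literature.NumberTheory.Rogawski1990.DepthZeroTransferHValuesTypeOneRamified             -- ★ p846978 (this seat): STUB B of the v0 skeleton; §1 bookkeeping (`indicator_one_mul_of_mem`, …)
import HarnessLib

/-!
# The two VERTEX-TYPE H-profiles at a TAME-RAMIFIED place, per vertex type, and the H-side BASIS `ψ^ram = ![1_{K⁰ × U₁}, 1_{K♯ × U₁}]` (v2 of the P-1-ram skeleton)

Topic `NumberTheory/Rogawski1990`; namespace `Literature.NumberTheory.Rogawski1990`.  THEOREMS ONLY (no definition, no instance, no notation, no named fact, no `sorry`);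
kernel lane `--supports stmt-HodgeConjecture-24833`.  Cell `pub/hodgecm-mathlib`, crux H413; road «S3-ram» seeding wave (LEAD F0P3a-plan (g12) T11-41; owner∕table F0P3a-p06 (g15)),
organ **«O8c-ram» FILE 2**: (§1) the CORE in explicit vertex-cover binders — for the pair `K₂ 0 = K⁰ = U(Φ₂) ∩ GL₂(𝒪_w)`, `K₂ 1 = K♯ = U(Φ₂) ∩ D_ϖ GL₂(𝒪_w) D_ϖ⁻¹` of ★
`exists_vertexCover_of_ramified` (the two special vertex types of the ramified `(q+1, q+1)`-tree), near `1`, on the `G`-regular elliptic type-(1) population with split eigen-data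
`α ≠ γ` at `w` of depth `N`:  `Φ^st(γ_H, 1_{K₂ ε × U₁}) = ν_H(K₂ ε × U₁) · Y♮ ε N`, `Y♮ ε N = 2·Σ_{j ≤ N, j ≡ ε, j+1 ≤ N} w′_j + [N ≡ ε]·w′_N·2` (`w′_0 = 1`, `w′_j = 2q^{⌊j∕2⌋}`;
the literal ★ EDGE ∕ VERTEX weights at window `m = 1`), EVERY Haar `ν_H`, every canonical family — citable per vertex type by the B₂′ ∕ C′ ∕ CERT hands; (§2) the text of
`stub_typeOne_HSideBasis_ram` of A-p16 (g31)'s skeleton **v2** (e79877dd9dcb92c5 :141) VERBATIM with the witnesses OF CONTENT `r := 2`, `ψ := ![1_{K⁰ × U₁}, 1_{K♯ × U₁}]`,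
`Y s N := (ν_H(K₂ s × U₁)∕ν_H(K_H))·Y♮ s N` (for `s = 0` the ratio is `1` since `K⁰ × U₁ = K_H`; for `s = 1` it is the canonical volume ratio of the two vertex stabilisers).
Companion of ★ p846978 `DepthZeroTransferHValuesTypeOneRamified` (STUB B of the v0 skeleton: `χ⁰` with END's residual condition, `χ♯` as a set-builder) — same proof (★ T6-1r
pair theorems `integral_conj_add_integral_conj_partner_eq_ramified_selfDual ∕ _modular` at `m = 1` over the ★ T6-1u′ adapter, ★ R-0c partner, ★ A-p01 eigenframe, `V` = the
residually-unipotent locus of `ι_v`).  HONEST LABEL: HC_CM is proved only modulo the cell's 2 remaining named inputs (hLiu418 24832, h413 24833) until rung 0 closes; «S3-ram» is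
Literature seeding with no books consequence; this file is an ASSEMBLY over ★ material and asserts nothing printed.

* §1 **`stableOrbitalIntegralRel_indicator_vertexTypes_ramified`** (core, explicit `K₂`-binders `hd0 hd1' hK₂o hK₂c`).
* §2 **`stableOrbitalIntegralRel_typeOne_HSideBasis_ramified`** = v2's `stub_typeOne_HSideBasis_ram` VERBATIM (closes it by `exact`, with content).

## References
* [Rogawski1990] J. D. Rogawski, *Automorphic Representations of Unitary Groups in Three Variables*, Ann. of Math. Stud. 123 (1990): §4.9 Lemma 4.9.3 p. 56, Prop. 4.9.1 (b) p. 55;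
  §8.1 Prop. 8.1.1 p. 112.
* [LabesseLanglands1979] J.-P. Labesse, R. P. Langlands, *L-indistinguishability for SL(2)*, Canad. J. Math. 31 (1979): §2 Lemma 2.1 pp. 8–9 (the ramified torus), §5.
* [Kottwitz1988] R. E. Kottwitz, *Tamagawa numbers*, Ann. of Math. 127 (1988): §2.
* [Serre1980Trees] J.-P. Serre, *Trees* (1980): Ch. II §1.1 (the two vertex types of a biregular tree).
-/

set_option autoImplicit false

noncomputable section

open Set Filter Topology MeasureTheory Measure NumberField IsDedekindDomain Finset Matrix Polynomial ValuativeRel Function MulAction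
open scoped Matrix MatrixGroups ValuativeRel WithZero

namespace Literature.NumberTheory.Rogawski1990

open Literature.NumberTheory.Automorphic Literature.NumberTheory.Automorphic.UnitaryGroup Literature.NumberTheory.Automorphic.IntegralReduction
open Literature.NumberTheory.GaloisRepresentations

/-- `![a, b]` is injective when `a ≠ b`. [cite: Rogawski1990, §3.1 p. 19] -/
private theorem injective_vecCons_two_O8cR {Y : Type*} {a b : Y} (h : a ≠ b) : Function.Injective ![a, b] := by
  intro i j hij
  fin_cases i <;> fin_cases j
  · rfl
  · exact absurd hij h
  · exact absurd hij.symm h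
  · rfl

/-! ## §1 The core: both vertex types, explicit cover binders -/

-- `L_w`-sized statement and a long composition: elaboration budget only (no search)
set_option maxHeartbeats 3200000 in
/-- **THE TWO VERTEX-TYPE H-PROFILES AT A TAME-RAMIFIED PLACE** (explicit binders for the vertex pair `K₂` of ★ `exists_vertexCover_of_ramified`): near `1` (on the residually-unipotent
locus of `ι_v`), for every `G`-regular elliptic type-(1) `γ_H` with split eigen-data `α ≠ γ` at `w` of depth `N`,
`Φ^st(γ_H, 1_{K₂ 0 × U₁}) = ν_H(K₂ 0 × U₁)·(2·S₀(N) + W₀(N)·2)` and `Φ^st(γ_H, 1_{K₂ 1 × U₁}) = ν_H(K₂ 1 × U₁)·(2·S₁(N) + W₁(N)·2)`, `S_π(N) = Σ_{j ≤ N, j ≡ π, j+1 ≤ N} w′_j`,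
`W_π(N) = [N ≡ π]·w′_N`, `w′_0 = 1`, `w′_j = 2q^{⌊j∕2⌋}` (★ EDGE ∕ VERTEX pair theorems at `m = 1` over the ★ T6-1u′ adapter).
[cite: Rogawski1990, §4.9 Lemma 4.9.3 p. 56; §8.1 Prop. 8.1.1 p. 112] [cite: LabesseLanglands1979, §2 Lemma 2.1 pp. 8–9, §5] [cite: Kottwitz1988, §2] -/
theorem stableOrbitalIntegralRel_indicator_vertexTypes_ramified
    (L : Type) [Field L] [NumberField L] [IsCMField L]
    {v : HeightOneSpectrum (𝓞 ↥(maximalRealSubfield L))} (w : PlacesOver L v)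
    (hw : IsCMField.complexConj L • w.1 = w.1) (he : v.asIdeal.ramificationIdx' w.1.asIdeal ≠ 1)
    (h2 : IsUnit (2 : 𝒪[(w.1.adicCompletion L)]))
    (ϖu : (w.1.adicCompletion L)ˣ) (hϖ' : Valued.v (ϖu : (w.1.adicCompletion L)) = WithZero.exp (-1 : ℤ))
    (hσϖ' : (galAdicCompletionMap (L := L) (IsCMField.complexConj L) hw) (ϖu : (w.1.adicCompletion L)) = -(ϖu : (w.1.adicCompletion L)))
    [MeasurableSpace ((cmDatum L 2 (Matrix.of fun i j : Fin 2 => if i.val + j.val + 1 = 2 then (1 : L) else 0)).Local v × (cmDatum L 1 (Matrix.of fun i j : Fin 1 => if i.val + j.val + 1 = 1 then (1 : L) else 0)).Local v)] [BorelSpace ((cmDatum L 2 (Matrix.of fun i j : Fin 2 => if i.val + j.val + 1 = 2 then (1 : L) else 0)).Local v × (cmDatum L 1 (Matrix.of fun i j : Fin 1 => if i.val + j.val + 1 = 1 then (1 : L) else 0)).Local v)]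
    [∀ a : ((cmDatum L 2 (Matrix.of fun i j : Fin 2 => if i.val + j.val + 1 = 2 then (1 : L) else 0)).Local v × (cmDatum L 1 (Matrix.of fun i j : Fin 1 => if i.val + j.val + 1 = 1 then (1 : L) else 0)).Local v), MeasurableSpace (((cmDatum L 2 (Matrix.of fun i j : Fin 2 => if i.val + j.val + 1 = 2 then (1 : L) else 0)).Local v × (cmDatum L 1 (Matrix.of fun i j : Fin 1 => if i.val + j.val + 1 = 1 then (1 : L) else 0)).Local v) ⧸ Subgroup.centralizer ({a} : Set ((cmDatum L 2 (Matrix.of fun i j : Fin 2 => if i.val + j.val + 1 = 2 then (1 : L) else 0)).Local v × (cmDatum L 1 (Matrix.of fun i j : Fin 1 => if i.val + j.val + 1 = 1 then (1 : L) else 0)).Local v)))]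
    [∀ a : ((cmDatum L 2 (Matrix.of fun i j : Fin 2 => if i.val + j.val + 1 = 2 then (1 : L) else 0)).Local v × (cmDatum L 1 (Matrix.of fun i j : Fin 1 => if i.val + j.val + 1 = 1 then (1 : L) else 0)).Local v), BorelSpace (((cmDatum L 2 (Matrix.of fun i j : Fin 2 => if i.val + j.val + 1 = 2 then (1 : L) else 0)).Local v × (cmDatum L 1 (Matrix.of fun i j : Fin 1 => if i.val + j.val + 1 = 1 then (1 : L) else 0)).Local v) ⧸ Subgroup.centralizer ({a} : Set ((cmDatum L 2 (Matrix.of fun i j : Fin 2 => if i.val + j.val + 1 = 2 then (1 : L) else 0)).Local v × (cmDatum L 1 (Matrix.of fun i j : Fin 1 => if i.val + j.val + 1 = 1 then (1 : L) else 0)).Local v)))]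
    (νH : Measure ((cmDatum L 2 (Matrix.of fun i j : Fin 2 => if i.val + j.val + 1 = 2 then (1 : L) else 0)).Local v × (cmDatum L 1 (Matrix.of fun i j : Fin 1 => if i.val + j.val + 1 = 1 then (1 : L) else 0)).Local v)) [νH.IsHaarMeasure] [νH.IsMulRightInvariant]
    {mH : OrbitalMeasureFamily ((cmDatum L 2 (Matrix.of fun i j : Fin 2 => if i.val + j.val + 1 = 2 then (1 : L) else 0)).Local v × (cmDatum L 1 (Matrix.of fun i j : Fin 1 => if i.val + j.val + 1 = 1 then (1 : L) else 0)).Local v)} (hmH : mH.IsCanonical (IsLocalGRegular L v) νH)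
    (K₂ : Fin 2 → Subgroup ((cmDatum L 2 (Matrix.of fun i j : Fin 2 => if i.val + j.val + 1 = 2 then (1 : L) else 0)).Local v))
    (hd0 : ∀ g, g ∈ K₂ 0 ↔ (((localNonsplitEquiv (IsCMField.complexConj L) (Matrix.of fun i j : Fin 2 => if i.val + j.val + 1 = 2 then (1 : L) else 0) (IsCMField.complexConj_ne_one L) w hw) g : ↥(unitaryGroupOfForm (galAdicCompletionMap (L := L) (IsCMField.complexConj L) hw) (placeForm (Matrix.of fun i j : Fin 2 => if i.val + j.val + 1 = 2 then (1 : L) else 0) w.1))) : GL (Fin 2) (w.1.adicCompletion L)) ∈ glInt 2 (w.1.adicCompletion L))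
    (hd1' : ∀ g, g ∈ K₂ 1 ↔ (((localNonsplitEquiv (IsCMField.complexConj L) (Matrix.of fun i j : Fin 2 => if i.val + j.val + 1 = 2 then (1 : L) else 0) (IsCMField.complexConj_ne_one L) w hw) g : ↥(unitaryGroupOfForm (galAdicCompletionMap (L := L) (IsCMField.complexConj L) hw) (placeForm (Matrix.of fun i j : Fin 2 => if i.val + j.val + 1 = 2 then (1 : L) else 0) w.1))) : GL (Fin 2) (w.1.adicCompletion L)) ∈ (glInt 2 (w.1.adicCompletion L)).map (MulAut.conj (glDiagonal 2 (w.1.adicCompletion L) ![1, ϖu])).toMonoidHom)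
    (hK₂o : ∀ ε, IsOpen (K₂ ε : Set ((cmDatum L 2 (Matrix.of fun i j : Fin 2 => if i.val + j.val + 1 = 2 then (1 : L) else 0)).Local v))) (hK₂c : ∀ ε, IsCompact (K₂ ε : Set ((cmDatum L 2 (Matrix.of fun i j : Fin 2 => if i.val + j.val + 1 = 2 then (1 : L) else 0)).Local v))) :
    ∃ V ∈ 𝓝 (1 : ((cmDatum L 2 (Matrix.of fun i j : Fin 2 => if i.val + j.val + 1 = 2 then (1 : L) else 0)).Local v × (cmDatum L 1 (Matrix.of fun i j : Fin 1 => if i.val + j.val + 1 = 1 then (1 : L) else 0)).Local v)),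
      ∀ γH ∈ V, IsLocalGRegular L v γH →
        (∃ x : (w.1.adicCompletion L), (((γH.1.val : GL (Fin 2) (UnitaryGroup.LocalRing L v)).val.map
          (Pi.evalRingHom (fun w' : PlacesOver L v => w'.1.adicCompletion L) w)).charpoly).IsRoot x) →
        ¬ (∃ (y : ((cmDatum L 2 (Matrix.of fun i j : Fin 2 => if i.val + j.val + 1 = 2 then (1 : L) else 0)).Local v × (cmDatum L 1 (Matrix.of fun i j : Fin 1 => if i.val + j.val + 1 = 1 then (1 : L) else 0)).Local v)) (d' : Fin 2 → (UnitaryGroup.LocalRing L v)ˣ),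
          glDiagonal 2 (UnitaryGroup.LocalRing L v) d' = ((y * γH * y⁻¹).1.val : GL (Fin 2) (UnitaryGroup.LocalRing L v))) →
        ∀ (α γ : (w.1.adicCompletion L)),
          ((((γH.1.val : GL (Fin 2) (UnitaryGroup.LocalRing L v)) : Matrix (Fin 2) (Fin 2) (UnitaryGroup.LocalRing L v)).charpoly).map (Pi.evalRingHom (fun w' : PlacesOver L v => w'.1.adicCompletion L) w)).IsRoot α →
          ((((γH.1.val : GL (Fin 2) (UnitaryGroup.LocalRing L v)) : Matrix (Fin 2) (Fin 2) (UnitaryGroup.LocalRing L v)).charpoly).map (Pi.evalRingHom (fun w' : PlacesOver L v => w'.1.adicCompletion L) w)).IsRoot γ →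
          α ≠ γ → ∀ N : ℕ, Valued.v (α - γ) = WithZero.exp (-(N : ℤ)) →
          (stableOrbitalIntegralRel (IsLocalStablyConjH L v) mH ((((K₂ 0).prod (⊤ : Subgroup ((cmDatum L 1 (Matrix.of fun i j : Fin 1 => if i.val + j.val + 1 = 1 then (1 : L) else 0)).Local v)) : Subgroup _) : Set ((cmDatum L 2 (Matrix.of fun i j : Fin 2 => if i.val + j.val + 1 = 2 then (1 : L) else 0)).Local v × (cmDatum L 1 (Matrix.of fun i j : Fin 1 => if i.val + j.val + 1 = 1 then (1 : L) else 0)).Local v)).indicator fun _ => (1 : ℂ)) γH =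
            ((νH.real (((K₂ 0).prod (⊤ : Subgroup ((cmDatum L 1 (Matrix.of fun i j : Fin 1 => if i.val + j.val + 1 = 1 then (1 : L) else 0)).Local v)) : Subgroup _) : Set ((cmDatum L 2 (Matrix.of fun i j : Fin 2 => if i.val + j.val + 1 = 2 then (1 : L) else 0)).Local v × (cmDatum L 1 (Matrix.of fun i j : Fin 1 => if i.val + j.val + 1 = 1 then (1 : L) else 0)).Local v)) : ℝ) : ℂ) *
          (((((2 * ∑ j ∈ (Finset.range (N + 1)).filter (fun j => j % 2 = 0 ∧ j + 1 ≤ N), (if j = 0 then 1 else 2 * (Nat.card (𝓞 ↥(maximalRealSubfield L) ⧸ v.asIdeal)) ^ (j / 2)) : ℕ)) : ℂ) +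
            ∑ i ∈ Finset.range 1, (((if i ≤ N ∧ (N - i) % 2 = 0 then (if N - i = 0 then 1 else 2 * (Nat.card (𝓞 ↥(maximalRealSubfield L) ⧸ v.asIdeal)) ^ ((N - i) / 2)) else 0 : ℕ)) : ℂ) * (1 + 1)))) ∧
          stableOrbitalIntegralRel (IsLocalStablyConjH L v) mH ((((K₂ 1).prod (⊤ : Subgroup ((cmDatum L 1 (Matrix.of fun i j : Fin 1 => if i.val + j.val + 1 = 1 then (1 : L) else 0)).Local v)) : Subgroup _) : Set ((cmDatum L 2 (Matrix.of fun i j : Fin 2 => if i.val + j.val + 1 = 2 then (1 : L) else 0)).Local v × (cmDatum L 1 (Matrix.of fun i j : Fin 1 => if i.val + j.val + 1 = 1 then (1 : L) else 0)).Local v)).indicator fun _ => (1 : ℂ)) γH =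
            ((νH.real (((K₂ 1).prod (⊤ : Subgroup ((cmDatum L 1 (Matrix.of fun i j : Fin 1 => if i.val + j.val + 1 = 1 then (1 : L) else 0)).Local v)) : Subgroup _) : Set ((cmDatum L 2 (Matrix.of fun i j : Fin 2 => if i.val + j.val + 1 = 2 then (1 : L) else 0)).Local v × (cmDatum L 1 (Matrix.of fun i j : Fin 1 => if i.val + j.val + 1 = 1 then (1 : L) else 0)).Local v)) : ℝ) : ℂ) *
          (((((2 * ∑ j ∈ (Finset.range (N + 1)).filter (fun j => j % 2 = 1 ∧ j + 1 ≤ N), (if j = 0 then 1 else 2 * (Nat.card (𝓞 ↥(maximalRealSubfield L) ⧸ v.asIdeal)) ^ (j / 2)) : ℕ)) : ℂ) +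
            ∑ i ∈ Finset.range 1, (((if i ≤ N ∧ (N - i) % 2 = 1 then (if N - i = 0 then 1 else 2 * (Nat.card (𝓞 ↥(maximalRealSubfield L) ⧸ v.asIdeal)) ^ ((N - i) / 2)) else 0 : ℕ)) : ℂ) * (1 + 1))) := by
  classical
  have hc1 : IsCMField.complexConj L ≠ 1 := IsCMField.complexConj_ne_one L
  haveI : Algebra.IsQuadraticExtension ↥(maximalRealSubfield L) L := IsCMField.isQuadraticExtension L
  haveI hv : Subsingleton (PlacesOver L v) := PlacesOver.subsingleton_of_smul_eq (IsCMField.complexConj L) hc1 w hw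
  -- `|2|_w = 1`
  have h2v : Valued.v (2 : w.1.adicCompletion L) = 1 := (isUnit_two_integer_iff_valued_eq_one L w.1).1 h2
  have hϖ1 : Valued.v (ϖu : w.1.adicCompletion L) ≤ 1 := by
    rw [hϖ', ← WithZero.exp_zero, WithZero.exp_le_exp]; norm_num
  have hϖO : (ϖu : w.1.adicCompletion L) ∈ 𝒪[w.1.adicCompletion L] := (v_le_one_iff_mem_integer _).1 hϖ1
  have hJ : (placeForm (Matrix.of fun i j : Fin 2 => if i.val + j.val + 1 = 2 then (1 : L) else 0) w.1) = !![0, 1; 1, 0] := placeForm_antidiagTwo_eq_swap_lit L v w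
  have hD := coe_glDiagonal_one_unit_eq L v w ϖu
  -- §a the one-place model, re-typed on the `cmDatum` carrier
  obtain ⟨E₂, hE₂⟩ : ∃ E₂ : (cmDatum L 2 (Matrix.of fun i j : Fin 2 => if i.val + j.val + 1 = 2 then (1 : L) else 0)).Local v ≃ₜ* ↥(unitaryGroupOfForm (galAdicCompletionMap (L := L) (IsCMField.complexConj L) hw) (placeForm (Matrix.of fun i j : Fin 2 => if i.val + j.val + 1 = 2 then (1 : L) else 0) w.1)), ∀ g,
      ((localNonsplitEquiv (IsCMField.complexConj L) (Matrix.of fun i j : Fin 2 => if i.val + j.val + 1 = 2 then (1 : L) else 0) (IsCMField.complexConj_ne_one L) w hw g : ↥(unitaryGroupOfForm (galAdicCompletionMap (L := L) (IsCMField.complexConj L) hw) (placeForm (Matrix.of fun i j : Fin 2 => if i.val + j.val + 1 = 2 then (1 : L) else 0) w.1))) : GL (Fin 2) (w.1.adicCompletion L)) = ((E₂ g : ↥(unitaryGroupOfForm (galAdicCompletionMap (L := L) (IsCMField.complexConj L) hw) (placeForm (Matrix.of fun i j : Fin 2 => if i.val + j.val + 1 = 2 then (1 : L) else 0) w.1)))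 : GL (Fin 2) (w.1.adicCompletion L)) :=
    ⟨localNonsplitEquiv (IsCMField.complexConj L) (Matrix.of fun i j : Fin 2 => if i.val + j.val + 1 = 2 then (1 : L) else 0) (IsCMField.complexConj_ne_one L) w hw, fun _ => rfl⟩
  have hE₂' : ∀ g, ((E₂ g : ↥(unitaryGroupOfForm (galAdicCompletionMap (L := L) (IsCMField.complexConj L) hw) (placeForm (Matrix.of fun i j : Fin 2 => if i.val + j.val + 1 = 2 then (1 : L) else 0) w.1))) : GL (Fin 2) (w.1.adicCompletion L)) = ((localNonsplitEquiv (IsCMField.complexConj L) (Matrix.of fun i j : Fin 2 => if i.val + j.val + 1 = 2 then (1 : L) else 0) (IsCMField.complexConj_ne_one L) w hw g : ↥(unitaryGroupOfForm (galAdicCompletionMap (L := L) (IsCMField.complexConj L) hw) (placeForm (Matrix.of fun i j : Fin 2 => if i.val + j.val + 1 = 2 then (1 : L) else 0) w.1))) : GL (Fin 2) (w.1.adicCompletion L)) :=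
    fun g => (hE₂ g).symm
  have hdict0 : ∀ g, g ∈ K₂ 0 ↔ E₂ g ∈ ((glInt 2 (w.1.adicCompletion L)).subgroupOf (unitaryGroupOfForm (galAdicCompletionMap (L := L) (IsCMField.complexConj L) hw) (placeForm (Matrix.of fun i j : Fin 2 => if i.val + j.val + 1 = 2 then (1 : L) else 0) w.1))) := fun g => by
    rw [Subgroup.mem_subgroupOf, hE₂']; exact hd0 g
  have hdict1 : ∀ g, g ∈ K₂ 1 ↔ E₂ g ∈ (((glInt 2 (w.1.adicCompletion L)).map (MulAut.conj (glDiagonal 2 (w.1.adicCompletion L) ![1, ϖu])).toMonoidHom).subgroupOf (unitaryGroupOfForm (galAdicCompletionMap (L := L) (IsCMField.complexConj L) hw) (placeForm (Matrix.of fun i j : Fin 2 => if i.val + j.val + 1 = 2 then (1 : L) else 0) w.1))) := fun g => by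
    rw [Subgroup.mem_subgroupOf, hE₂']; exact hd1' g
  -- `K₁ = U(Φ₁)_v`; `K_H = K₂ × K₁ = K₂ 0 × ⊤` as a set; openness, compactness
  have hK1 : cmLocalIntegralLevel L 1 (Matrix.of fun i j : Fin 1 => if i.val + j.val + 1 = 1 then (1 : L) else 0) v = ⊤ :=
    cmLocalIntegralLevel_one_eq_top_of_smul_eq L _ w hw (isUnit_placeForm_antidiagOne (E := L) 1 w.1)
  have hopen : ∀ ε, IsOpen (((K₂ ε).prod (⊤ : Subgroup ((cmDatum L 1 (Matrix.of fun i j : Fin 1 => if i.val + j.val + 1 = 1 then (1 : L) else 0)).Local v)) : Subgroup _) : Set ((cmDatum L 2 (Matrix.of fun i j : Fin 2 => if i.val + j.val + 1 = 2 then (1 : L) else 0)).Local v × (cmDatum L 1 (Matrix.of fun i j : Fin 1 => if i.val + j.val + 1 = 1 then (1 : L) else 0)).Local v)) := fun ε => by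
    rw [Subgroup.coe_prod, Subgroup.coe_top]; exact (hK₂o ε).prod isOpen_univ
  have hcpt : ∀ ε, IsCompact (((K₂ ε).prod (⊤ : Subgroup ((cmDatum L 1 (Matrix.of fun i j : Fin 1 => if i.val + j.val + 1 = 1 then (1 : L) else 0)).Local v)) : Subgroup _) : Set ((cmDatum L 2 (Matrix.of fun i j : Fin 2 => if i.val + j.val + 1 = 2 then (1 : L) else 0)).Local v × (cmDatum L 1 (Matrix.of fun i j : Fin 1 => if i.val + j.val + 1 = 1 then (1 : L) else 0)).Local v)) := fun ε => by
    have h1 := (isCompact_isOpen_cmLocalIntegralLevel L 1 (Matrix.of fun i j : Fin 1 => if i.val + j.val + 1 = 1 then (1 : L) else 0) v).1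
    rw [hK1, Subgroup.coe_top] at h1
    rw [Subgroup.coe_prod, Subgroup.coe_top]; exact (hK₂c ε).prod h1
  -- the two pieces `φ⁰ = 1_{K⁰ × U₁}`, `φ♯ = 1_{K♯ × U₁}`
  obtain ⟨φp, hφp⟩ : ∃ φp : Fin 2 → ((cmDatum L 2 (Matrix.of fun i j : Fin 2 => if i.val + j.val + 1 = 2 then (1 : L) else 0)).Local v × (cmDatum L 1 (Matrix.of fun i j : Fin 1 => if i.val + j.val + 1 = 1 then (1 : L) else 0)).Local v) → ℂ,
      ∀ ε, φp ε = (((K₂ ε).prod (⊤ : Subgroup ((cmDatum L 1 (Matrix.of fun i j : Fin 1 => if i.val + j.val + 1 = 1 then (1 : L) else 0)).Local v)) : Subgroup _) : Set ((cmDatum L 2 (Matrix.of fun i j : Fin 2 => if i.val + j.val + 1 = 2 then (1 : L) else 0)).Local v × (cmDatum L 1 (Matrix.of fun i j : Fin 1 => if i.val + j.val + 1 = 1 then (1 : L) else 0)).Local v)).indicator fun _ => (1 : ℂ) :=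
    ⟨_, fun _ => rfl⟩
  have hφs : ∀ ε, tsupport (φp ε) ⊆ (((K₂ ε).prod (⊤ : Subgroup ((cmDatum L 1 (Matrix.of fun i j : Fin 1 => if i.val + j.val + 1 = 1 then (1 : L) else 0)).Local v)) : Subgroup _) : Set ((cmDatum L 2 (Matrix.of fun i j : Fin 2 => if i.val + j.val + 1 = 2 then (1 : L) else 0)).Local v × (cmDatum L 1 (Matrix.of fun i j : Fin 1 => if i.val + j.val + 1 = 1 then (1 : L) else 0)).Local v)) := fun ε => by
    rw [hφp]; exact tsupport_indicator_one_subset_of_isClosed (Subgroup.isClosed_of_isOpen _ (hopen ε))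
  have hφK : ∀ ε, ∀ k ∈ ((K₂ ε).prod (⊤ : Subgroup ((cmDatum L 1 (Matrix.of fun i j : Fin 1 => if i.val + j.val + 1 = 1 then (1 : L) else 0)).Local v)) : Subgroup _), ∀ x, φp ε (k * x * k⁻¹) = φp ε x :=
    fun ε k hk x => by rw [hφp]; exact indicator_one_conj_of_mem _ hk x
  have hφsm : ∀ ε, IsLocSmooth (φp ε) := fun ε => by rw [hφp]; exact isLocSmooth_indicator_subgroup _ (hopen ε) (hcpt ε)
  -- values of the pieces on (`D_ϖ`-)integral elements
  have hval0 : ∀ (y : ↥(unitaryGroupOfForm (galAdicCompletionMap (L := L) (IsCMField.complexConj L) hw) (placeForm (Matrix.of fun i j : Fin 2 => if i.val + j.val + 1 = 2 then (1 : L) else 0) w.1)))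
      (a : (cmDatum L 1 (Matrix.of fun i j : Fin 1 => if i.val + j.val + 1 = 1 then (1 : L) else 0)).Local v),
      (y : GL (Fin 2) (w.1.adicCompletion L)) ∈ glInt 2 (w.1.adicCompletion L) → φp 0 (E₂.symm y, a) = 1 := fun y a hy => by
    rw [hφp]
    refine Set.indicator_of_mem (Subgroup.mem_prod.2 ⟨(hdict0 _).2 ?_, Subgroup.mem_top _⟩) _
    rw [Subgroup.mem_subgroupOf, ContinuousMulEquiv.apply_symm_apply]; exact hy
  have hval1 : ∀ (y : ↥(unitaryGroupOfForm (galAdicCompletionMap (L := L) (IsCMField.complexConj L) hw) (placeForm (Matrix.of fun i j : Fin 2 => if i.val + j.val + 1 = 2 then (1 : L) else 0) w.1)))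
      (a : (cmDatum L 1 (Matrix.of fun i j : Fin 1 => if i.val + j.val + 1 = 1 then (1 : L) else 0)).Local v),
      (y : GL (Fin 2) (w.1.adicCompletion L)) ∈ (glInt 2 (w.1.adicCompletion L)).map (MulAut.conj (glDiagonal 2 (w.1.adicCompletion L) ![1, ϖu])).toMonoidHom → φp 1 (E₂.symm y, a) = 1 :=
    fun y a hy => by
    rw [hφp]
    refine Set.indicator_of_mem (Subgroup.mem_prod.2 ⟨(hdict1 _).2 ?_, Subgroup.mem_top _⟩) _
    rw [Subgroup.mem_subgroupOf, ContinuousMulEquiv.apply_symm_apply]; exact hy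
  -- level-one subgroups and the right-invariance of the pieces (window `m = 1`)
  have hlcI : ∀ g : GL (Fin 2) (w.1.adicCompletion L), g ∈ localCongruenceSubgroup 2 L w.1 1 → g ∈ glInt 2 (w.1.adicCompletion L) := fun g hg => by
    obtain ⟨hg1, hg2, -⟩ := hg
    exact (mem_glInt_iff_forall_v_le_one g).2 ⟨hg1, hg2⟩
  have hKm0 : ∀ y : ↥(unitaryGroupOfForm (galAdicCompletionMap (L := L) (IsCMField.complexConj L) hw) (placeForm (Matrix.of fun i j : Fin 2 => if i.val + j.val + 1 = 2 then (1 : L) else 0) w.1)),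
      (∀ r s, (ϖu : w.1.adicCompletion L) ^ (-((1 : ℕ) : ℤ)) * ((((y : ↥(unitaryGroupOfForm (galAdicCompletionMap (L := L) (IsCMField.complexConj L) hw) (placeForm (Matrix.of fun i j : Fin 2 => if i.val + j.val + 1 = 2 then (1 : L) else 0) w.1))) : GL (Fin 2) (w.1.adicCompletion L)) : Matrix (Fin 2) (Fin 2) (w.1.adicCompletion L)) - 1) r s ∈ 𝒪[w.1.adicCompletion L]) →
      y ∈ (localCongruenceSubgroup 2 L w.1 1).subgroupOf (unitaryGroupOfForm (galAdicCompletionMap (L := L) (IsCMField.complexConj L) hw) (placeForm (Matrix.of fun i j : Fin 2 => if i.val + j.val + 1 = 2 then (1 : L) else 0) w.1)) :=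
    fun y hy => Subgroup.mem_subgroupOf.2 (mem_localCongruenceSubgroup_of_forall_zpow_neg_mul_sub_one_mem_of_v_eq L v w hϖ' le_rfl hy)
  have hKm1 : ∀ y : ↥(unitaryGroupOfForm (galAdicCompletionMap (L := L) (IsCMField.complexConj L) hw) (placeForm (Matrix.of fun i j : Fin 2 => if i.val + j.val + 1 = 2 then (1 : L) else 0) w.1)),
      (∀ r s, (ϖu : w.1.adicCompletion L) ^ (-((1 : ℕ) : ℤ)) *
        (((((glDiagonal 2 (w.1.adicCompletion L) ![1, ϖu])⁻¹ * ((y : ↥(unitaryGroupOfForm (galAdicCompletionMap (L := L) (IsCMField.complexConj L) hw) (placeForm (Matrix.of fun i j : Fin 2 => if i.val + j.val + 1 = 2 then (1 : L) else 0) w.1))) : GL (Fin 2) (w.1.adicCompletion L)) * (glDiagonal 2 (w.1.adicCompletion L) ![1, ϖu]) : GL (Fin 2) (w.1.adicCompletion L))) : Matrix (Fin 2) (Fin 2) (w.1.adicCompletion L)) - 1) r s ∈ 𝒪[w.1.adicCompletion L]) →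
      y ∈ ((localCongruenceSubgroup 2 L w.1 1).map (MulAut.conj (glDiagonal 2 (w.1.adicCompletion L) ![1, ϖu])).toMonoidHom).subgroupOf (unitaryGroupOfForm (galAdicCompletionMap (L := L) (IsCMField.complexConj L) hw) (placeForm (Matrix.of fun i j : Fin 2 => if i.val + j.val + 1 = 2 then (1 : L) else 0) w.1)) :=
    fun y hy => by
    refine Subgroup.mem_subgroupOf.2 (Subgroup.mem_map_equiv.2 ?_)
    rw [MulAut.conj_symm_apply]
    exact mem_localCongruenceSubgroup_of_forall_zpow_neg_mul_sub_one_mem_of_v_eq L v w hϖ' le_rfl hy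
  have hφm0 : ∀ (a : (cmDatum L 1 (Matrix.of fun i j : Fin 1 => if i.val + j.val + 1 = 1 then (1 : L) else 0)).Local v)
      (x' : ↥(unitaryGroupOfForm (galAdicCompletionMap (L := L) (IsCMField.complexConj L) hw) (placeForm (Matrix.of fun i j : Fin 2 => if i.val + j.val + 1 = 2 then (1 : L) else 0) w.1))),
      ∀ y ∈ (localCongruenceSubgroup 2 L w.1 1).subgroupOf (unitaryGroupOfForm (galAdicCompletionMap (L := L) (IsCMField.complexConj L) hw) (placeForm (Matrix.of fun i j : Fin 2 => if i.val + j.val + 1 = 2 then (1 : L) else 0) w.1)),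
        φp 0 (E₂.symm (x' * y), a) = φp 0 (E₂.symm x', a) := by
    intro a x' y hy
    have hyK : E₂.symm y ∈ K₂ 0 := (hdict0 _).2 (by
      rw [Subgroup.mem_subgroupOf, ContinuousMulEquiv.apply_symm_apply]; exact hlcI _ (Subgroup.mem_subgroupOf.1 hy))
    have hmem : ((E₂.symm y, 1) : (cmDatum L 2 (Matrix.of fun i j : Fin 2 => if i.val + j.val + 1 = 2 then (1 : L) else 0)).Local v × (cmDatum L 1 (Matrix.of fun i j : Fin 1 => if i.val + j.val + 1 = 1 then (1 : L) else 0)).Local v) ∈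
        ((K₂ 0).prod (⊤ : Subgroup ((cmDatum L 1 (Matrix.of fun i j : Fin 1 => if i.val + j.val + 1 = 1 then (1 : L) else 0)).Local v)) : Subgroup _) :=
      Subgroup.mem_prod.2 ⟨hyK, Subgroup.mem_top _⟩
    have hsplit : ((E₂.symm (x' * y), a) : (cmDatum L 2 (Matrix.of fun i j : Fin 2 => if i.val + j.val + 1 = 2 then (1 : L) else 0)).Local v × (cmDatum L 1 (Matrix.of fun i j : Fin 1 => if i.val + j.val + 1 = 1 then (1 : L) else 0)).Local v) =
        (E₂.symm x', a) * (E₂.symm y, 1) := by rw [map_mul, Prod.mk_mul_mk, mul_one]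
    rw [hφp, hsplit]; exact indicator_one_mul_of_mem _ hmem _
  have hφm1 : ∀ (a : (cmDatum L 1 (Matrix.of fun i j : Fin 1 => if i.val + j.val + 1 = 1 then (1 : L) else 0)).Local v)
      (x' : ↥(unitaryGroupOfForm (galAdicCompletionMap (L := L) (IsCMField.complexConj L) hw) (placeForm (Matrix.of fun i j : Fin 2 => if i.val + j.val + 1 = 2 then (1 : L) else 0) w.1))),
      ∀ y ∈ ((localCongruenceSubgroup 2 L w.1 1).map (MulAut.conj (glDiagonal 2 (w.1.adicCompletion L) ![1, ϖu])).toMonoidHom).subgroupOf (unitaryGroupOfForm (galAdicCompletionMap (L := L) (IsCMField.complexConj L) hw) (placeForm (Matrix.of fun i j : Fin 2 => if i.val + j.val + 1 = 2 then (1 : L) else 0) w.1)),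
        φp 1 (E₂.symm (x' * y), a) = φp 1 (E₂.symm x', a) := by
    intro a x' y hy
    obtain ⟨g, hg, hgy⟩ := Subgroup.mem_map.1 (Subgroup.mem_subgroupOf.1 hy)
    have hyK : E₂.symm y ∈ K₂ 1 := (hdict1 _).2 (by
      rw [Subgroup.mem_subgroupOf, ContinuousMulEquiv.apply_symm_apply]; exact Subgroup.mem_map.2 ⟨g, hlcI g hg, hgy⟩)
    have hmem : ((E₂.symm y, 1) : (cmDatum L 2 (Matrix.of fun i j : Fin 2 => if i.val + j.val + 1 = 2 then (1 : L) else 0)).Local v × (cmDatum L 1 (Matrix.of fun i j : Fin 1 => if i.val + j.val + 1 = 1 then (1 : L) else 0)).Local v) ∈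
        ((K₂ 1).prod (⊤ : Subgroup ((cmDatum L 1 (Matrix.of fun i j : Fin 1 => if i.val + j.val + 1 = 1 then (1 : L) else 0)).Local v)) : Subgroup _) :=
      Subgroup.mem_prod.2 ⟨hyK, Subgroup.mem_top _⟩
    have hsplit : ((E₂.symm (x' * y), a) : (cmDatum L 2 (Matrix.of fun i j : Fin 2 => if i.val + j.val + 1 = 2 then (1 : L) else 0)).Local v × (cmDatum L 1 (Matrix.of fun i j : Fin 1 => if i.val + j.val + 1 = 1 then (1 : L) else 0)).Local v) =
        (E₂.symm x', a) * (E₂.symm y, 1) := by rw [map_mul, Prod.mk_mul_mk, mul_one]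
    rw [hφp, hsplit]; exact indicator_one_mul_of_mem _ hmem _
  -- the adapter's structural inputs for `Reg = IsLocalGRegular`
  have hReg : ∀ γ : ((cmDatum L 2 (Matrix.of fun i j : Fin 2 => if i.val + j.val + 1 = 2 then (1 : L) else 0)).Local v × (cmDatum L 1 (Matrix.of fun i j : Fin 1 => if i.val + j.val + 1 = 1 then (1 : L) else 0)).Local v),
      IsLocalGRegular L v γ → IsRegularElt (γ.1.val : GL (Fin 2) (LocalRing L v)) := fun γ hγ => (isRegularElt_fst_snd_of_isLocalGRegular L v γ hγ).1
  have hconj : ∀ γ x : ((cmDatum L 2 (Matrix.of fun i j : Fin 2 => if i.val + j.val + 1 = 2 then (1 : L) else 0)).Local v × (cmDatum L 1 (Matrix.of fun i j : Fin 1 => if i.val + j.val + 1 = 1 then (1 : L) else 0)).Local v),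
      IsLocalGRegular L v γ → IsLocalGRegular L v (x * γ * x⁻¹) := fun γ x hγ => (isLocalGRegular_conj_iff L x γ).2 hγ
  have hstab : ∀ γ δ : ((cmDatum L 2 (Matrix.of fun i j : Fin 2 => if i.val + j.val + 1 = 2 then (1 : L) else 0)).Local v × (cmDatum L 1 (Matrix.of fun i j : Fin 1 => if i.val + j.val + 1 = 1 then (1 : L) else 0)).Local v),
      IsLocalGRegular L v γ → IsLocalStablyConjH L v γ δ → IsLocalGRegular L v δ := fun γ δ hγ hst => isLocalGRegular_of_isLocalStablyConjH L v hst hγ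
  refine ⟨_, setOf_residuallyUnipotent_endoEmbLocal_mem_nhds_one L v w, ?_⟩
  intro γH hγV hreg _ hell α γ hα hγ hαγ N hN
  simp only [Set.mem_setOf_eq] at hγV
  -- DEEPNESS on `V`: the eigenvalues `α, γ` of `γ_H` at `w` are `≡ 1 (mod 𝔪_w)`, hence `N ≥ 1`
  have hfac := charpoly_map_endoEmbLocal_apply L w (γH := γH)
  have hcm : ((((γH.1.val : GL (Fin 2) (LocalRing L v)).val).map (Pi.evalRingHom (fun w' : PlacesOver L v => w'.1.adicCompletion L) w))).charpoly =
      ((((γH.1.val : GL (Fin 2) (LocalRing L v)) : Matrix (Fin 2) (Fin 2) (LocalRing L v)).charpoly).map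
        (Pi.evalRingHom (fun w' : PlacesOver L v => w'.1.adicCompletion L) w)) := Matrix.charpoly_map _ _
  have hα1 : Valued.v (α - 1) < 1 := by
    refine valuation_sub_one_lt_one_of_isRoot_charpoly_of_residuallyUnipotent _ hγV ?_
    rw [hfac, Polynomial.IsRoot, eval_mul, hcm, hα.eq_zero, zero_mul]
  have hγ1 : Valued.v (γ - 1) < 1 := by
    refine valuation_sub_one_lt_one_of_isRoot_charpoly_of_residuallyUnipotent _ hγV ?_
    rw [hfac, Polynomial.IsRoot, eval_mul, hcm, hγ.eq_zero, zero_mul]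
  have hN1 : 1 ≤ N := by
    have hlt : Valued.v (α - γ) < 1 := by
      have e : α - γ = (α - 1) - (γ - 1) := by ring
      rw [e]
      exact lt_of_le_of_lt (Valuation.map_sub _ _ _) (max_lt hα1 hγ1)
    rw [hN, ← WithZero.exp_zero, WithZero.exp_lt_exp] at hlt
    omega
  -- the frame of `γ_H`: eigenframe `P` through `α`, second eigenvalue `γ`, norm-one eigen-data `u`
  have hsep : (((γH.1.val : GL (Fin 2) (LocalRing L v)) : Matrix (Fin 2) (Fin 2) (LocalRing L v)).charpoly).Separable :=
    (isRegularElt_fst_snd_of_isLocalGRegular L v γH hreg).1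
  obtain ⟨P, u, hP, hu, hu0⟩ := exists_eigenframe_cmDatum_local_of_isRoot_map_of_separable L v w hw γH.1 hα hsep
  have hu1w : u 1 w = γ := by
    rcases eq_or_eq_eval_of_isRoot_of_eigenframe L v w hP hγ with h | h
    · exact absurd (h.trans hu0) (Ne.symm hαγ)
    · exact h.symm
  have hu1 : ∀ i, conjLocal L (IsCMField.complexConj L) v (u i) * u i = 1 :=
    forall_conjLocal_mul_eq_one_of_not_exists_conj_glDiagonal L v w hw hP hu hell
  have ht₀ : IsRegularElt (γH.1.val : GL (Fin 2) (LocalRing L v)) := hsep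
  have hP' : (γH.1.val.val : Matrix (Fin 2) (Fin 2) (LocalRing L v)) * P.val = P.val * Matrix.diagonal u := hP
  -- ★ R-0c: `σ_w` on `𝒪_w`, the non-square unit `uu = ↑η`, the unit-similitude partner `e` with its one-place conjugation law and `hest`
  obtain ⟨σO, rL, hru, uu, η, e, hσO', hσσ, hres, h2O, hηu', hηu, hση, hη, hvu, -, hAd, -, hest, -, -, hconjL, -, -⟩ :=
    UnitaryGroup.exists_unitSimilitudePartner_residueBit_of_ramified L v w hw he h2v γH P u ht₀ hP' hu1
  have he2 : ∀ a : ((cmDatum L 2 (Matrix.of fun i j : Fin 2 => if i.val + j.val + 1 = 2 then (1 : L) else 0)).Local v × (cmDatum L 1 (Matrix.of fun i j : Fin 1 => if i.val + j.val + 1 = 1 then (1 : L) else 0)).Local v), (e a).2 = a.2 := fun a => (hAd a).2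
  have hconjE : ∀ a : ((cmDatum L 2 (Matrix.of fun i j : Fin 2 => if i.val + j.val + 1 = 2 then (1 : L) else 0)).Local v × (cmDatum L 1 (Matrix.of fun i j : Fin 1 => if i.val + j.val + 1 = 1 then (1 : L) else 0)).Local v), ((E₂ (e a).1 : ↥(unitaryGroupOfForm (galAdicCompletionMap (L := L) (IsCMField.complexConj L) hw) (placeForm (Matrix.of fun i j : Fin 2 => if i.val + j.val + 1 = 2 then (1 : L) else 0) w.1))) : GL (Fin 2) (w.1.adicCompletion L)) =
      (glDiagonal 2 (w.1.adicCompletion L) ![1, uu]) * ((E₂ a.1 : ↥(unitaryGroupOfForm (galAdicCompletionMap (L := L) (IsCMField.complexConj L) hw) (placeForm (Matrix.of fun i j : Fin 2 => if i.val + j.val + 1 = 2 then (1 : L) else 0) w.1))) : GL (Fin 2) (w.1.adicCompletion L)) * ((glDiagonal 2 (w.1.adicCompletion L) ![1, uu]))⁻¹ := fun a => by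
    rw [hE₂', hE₂']; exact hconjL a
  have hσu : (galAdicCompletionMap (L := L) (IsCMField.complexConj L) hw) (uu : w.1.adicCompletion L) = uu := by rw [← hηu', ← hσO', hση]
  have hσηL : (galAdicCompletionMap (L := L) (IsCMField.complexConj L) hw) ((η : 𝒪[w.1.adicCompletion L]) : w.1.adicCompletion L) = ((η : 𝒪[w.1.adicCompletion L]) : w.1.adicCompletion L) := by
    rw [hηu']; exact hσu
  -- the frame at `w`: eigenvalues `(α, γ)`, distinct, of norm one
  have hZ : γH ∈ Subgroup.centralizer ({γH} : Set ((cmDatum L 2 (Matrix.of fun i j : Fin 2 => if i.val + j.val + 1 = 2 then (1 : L) else 0)).Local v × (cmDatum L 1 (Matrix.of fun i j : Fin 1 => if i.val + j.val + 1 = 1 then (1 : L) else 0)).Local v)) :=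
    Subgroup.mem_centralizer_singleton_iff.2 rfl
  have hτ : ∀ i : Fin 2, ((P⁻¹).val * (((⟨γH, hZ⟩ : ↥(Subgroup.centralizer ({γH} : Set ((cmDatum L 2 (Matrix.of fun i j : Fin 2 => if i.val + j.val + 1 = 2 then (1 : L) else 0)).Local v × (cmDatum L 1 (Matrix.of fun i j : Fin 1 => if i.val + j.val + 1 = 1 then (1 : L) else 0)).Local v)))) : ((cmDatum L 2 (Matrix.of fun i j : Fin 2 => if i.val + j.val + 1 = 2 then (1 : L) else 0)).Local v × (cmDatum L 1 (Matrix.of fun i j : Fin 1 => if i.val + j.val + 1 = 1 then (1 : L) else 0)).Local v)).1.val.val : Matrix (Fin 2) (Fin 2) (LocalRing L v)) * P.val) i i = u i := by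
    intro i
    have h : (P⁻¹).val * (((⟨γH, hZ⟩ : ↥(Subgroup.centralizer ({γH} : Set ((cmDatum L 2 (Matrix.of fun i j : Fin 2 => if i.val + j.val + 1 = 2 then (1 : L) else 0)).Local v × (cmDatum L 1 (Matrix.of fun i j : Fin 1 => if i.val + j.val + 1 = 1 then (1 : L) else 0)).Local v)))) : ((cmDatum L 2 (Matrix.of fun i j : Fin 2 => if i.val + j.val + 1 = 2 then (1 : L) else 0)).Local v × (cmDatum L 1 (Matrix.of fun i j : Fin 1 => if i.val + j.val + 1 = 1 then (1 : L) else 0)).Local v)).1.val.val : Matrix (Fin 2) (Fin 2) (LocalRing L v)) * P.val = Matrix.diagonal u := by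
      rw [Matrix.mul_assoc, show (((⟨γH, hZ⟩ : ↥(Subgroup.centralizer ({γH} : Set ((cmDatum L 2 (Matrix.of fun i j : Fin 2 => if i.val + j.val + 1 = 2 then (1 : L) else 0)).Local v × (cmDatum L 1 (Matrix.of fun i j : Fin 1 => if i.val + j.val + 1 = 1 then (1 : L) else 0)).Local v)))) : ((cmDatum L 2 (Matrix.of fun i j : Fin 2 => if i.val + j.val + 1 = 2 then (1 : L) else 0)).Local v × (cmDatum L 1 (Matrix.of fun i j : Fin 1 => if i.val + j.val + 1 = 1 then (1 : L) else 0)).Local v)).1.val.val : Matrix (Fin 2) (Fin 2) (LocalRing L v)) = (γH.1.val.val : Matrix (Fin 2) (Fin 2) (LocalRing L v)) from rfl, hP', ← Matrix.mul_assoc,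
        show (P⁻¹).val * P.val = 1 from P.inv_mul, Matrix.one_mul]
    rw [h, Matrix.diagonal_apply_eq]
  have hd01w : u 0 w ≠ u 1 w := by rw [hu0, hu1w]; exact hαγ
  have hdw : Function.Injective ![u 0 w, u 1 w] := injective_vecCons_two_O8cR hd01w
  have hσw : ∀ x : LocalRing L v, conjLocal L (IsCMField.complexConj L) v x w = (galAdicCompletionMap (L := L) (IsCMField.complexConj L) hw) (x w) := fun x =>
    conjLocal_apply_eq_galAdicCompletionMap L v w hw x
  have hd1w : ∀ i, (galAdicCompletionMap (L := L) (IsCMField.complexConj L) hw) (![u 0 w, u 1 w] i) * ![u 0 w, u 1 w] i = 1 := by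
    intro i
    fin_cases i
    · have h := congrArg (fun x : LocalRing L v => x w) (hu1 0)
      simpa only [Fin.zero_eta, Fin.mk_one, Matrix.cons_val_zero, Matrix.cons_val_one, Matrix.head_cons, Pi.mul_apply, Pi.one_apply, hσw] using h
    · have h := congrArg (fun x : LocalRing L v => x w) (hu1 1)
      simpa only [Fin.zero_eta, Fin.mk_one, Matrix.cons_val_zero, Matrix.cons_val_one, Matrix.head_cons, Pi.mul_apply, Pi.one_apply, hσw] using h
  have hPw : (((E₂ γH.1 : ↥(unitaryGroupOfForm (galAdicCompletionMap (L := L) (IsCMField.complexConj L) hw) (placeForm (Matrix.of fun i j : Fin 2 => if i.val + j.val + 1 = 2 then (1 : L) else 0) w.1))) : GL (Fin 2) (w.1.adicCompletion L)) : Matrix (Fin 2) (Fin 2) (w.1.adicCompletion L)) * ((((Matrix.GeneralLinearGroup.map (Pi.evalRingHom (fun w' : PlacesOver L v => w'.1.adicCompletion L) w) P) : GL (Fin 2) (w.1.adicCompletion L)) : GL (Fin 2) (w.1.adicCompletion L)) : Matrix (Fin 2) (Fin 2) (w.1.adicCompletion L)) =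
      ((((Matrix.GeneralLinearGroup.map (Pi.evalRingHom (fun w' : PlacesOver L v => w'.1.adicCompletion L) w) P) : GL (Fin 2) (w.1.adicCompletion L)) : GL (Fin 2) (w.1.adicCompletion L)) : Matrix (Fin 2) (Fin 2) (w.1.adicCompletion L)) * diagonal ![u 0 w, u 1 w] := by
    have h := coe_localNonsplitEquiv_mul_map_eq L v w hw γH.1 P (Matrix.diagonal u) hP'
    rw [hE₂', h, Matrix.diagonal_map (map_zero _)]
    congr 1
    funext i
    fin_cases i <;> rfl
  -- ★ A-p01: the unit-Gram eigenframe `Q` of `E₂ γ_H.1`, framing the whole torus (★ A-29 (a))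
  obtain ⟨Q, hfr, rQ, hQ₀, hhv, hσh, hQh, hr, hsq⟩ :=
    exists_diagonal_unit_eigenframe_antidiagTwo_of_ramified L v w hw he h2v σO hσO' hres (E₂ γH.1).2 hPw hdw hd1w
  have hh : ∀ i, Valued.v (hfr i) = 1 := fun i => (v_eq_one_iff_valuation_eq_one (hfr i)).2 (hhv i)
  have hQ := frameEntry_frame_of_eigenframe L v w hw γH P u ht₀ hP' hu1 E₂ hE₂' Q hQ₀
  -- §d scalar and window value families along `Z(γ_H)` (plain: ★ signed normal forms; `D_ϖ`-conjugated: ★ modular normal forms)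
  have hcw : ∀ t : ↥(Subgroup.centralizer ({γH} : Set ((cmDatum L 2 (Matrix.of fun i j : Fin 2 => if i.val + j.val + 1 = 2 then (1 : L) else 0)).Local v × (cmDatum L 1 (Matrix.of fun i j : Fin 1 => if i.val + j.val + 1 = 1 then (1 : L) else 0)).Local v))),
      (galAdicCompletionMap (L := L) (IsCMField.complexConj L) hw) ((((P⁻¹).val * ((t : ((cmDatum L 2 (Matrix.of fun i j : Fin 2 => if i.val + j.val + 1 = 2 then (1 : L) else 0)).Local v × (cmDatum L 1 (Matrix.of fun i j : Fin 1 => if i.val + j.val + 1 = 1 then (1 : L) else 0)).Local v)).1.val.val : Matrix (Fin 2) (Fin 2) (LocalRing L v)) * P.val) 1 1) w) *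
        ((((P⁻¹).val * ((t : ((cmDatum L 2 (Matrix.of fun i j : Fin 2 => if i.val + j.val + 1 = 2 then (1 : L) else 0)).Local v × (cmDatum L 1 (Matrix.of fun i j : Fin 1 => if i.val + j.val + 1 = 1 then (1 : L) else 0)).Local v)).1.val.val : Matrix (Fin 2) (Fin 2) (LocalRing L v)) * P.val) 1 1) w) = 1 := fun t => by
    have h := congrArg (fun x : LocalRing L v => x w) (conjLocal_frameEntry_mul_self_apply L v w hw γH P u ht₀ hP' hu1 t 1)
    simpa only [Pi.mul_apply, Pi.one_apply, conjLocal_apply_eq_galAdicCompletionMap L v w hw] using h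
  have hcv : ∀ t : ↥(Subgroup.centralizer ({γH} : Set ((cmDatum L 2 (Matrix.of fun i j : Fin 2 => if i.val + j.val + 1 = 2 then (1 : L) else 0)).Local v × (cmDatum L 1 (Matrix.of fun i j : Fin 1 => if i.val + j.val + 1 = 1 then (1 : L) else 0)).Local v))),
      valuation (w.1.adicCompletion L) ((((P⁻¹).val * ((t : ((cmDatum L 2 (Matrix.of fun i j : Fin 2 => if i.val + j.val + 1 = 2 then (1 : L) else 0)).Local v × (cmDatum L 1 (Matrix.of fun i j : Fin 1 => if i.val + j.val + 1 = 1 then (1 : L) else 0)).Local v)).1.val.val : Matrix (Fin 2) (Fin 2) (LocalRing L v)) * P.val) 1 1) w) = 1 := fun t =>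
    valuation_eq_one_of_galAdicCompletionMap_mul_self L v w hw (hcw t)
  have hexE : ∀ t : ↥(Subgroup.centralizer ({γH} : Set ((cmDatum L 2 (Matrix.of fun i j : Fin 2 => if i.val + j.val + 1 = 2 then (1 : L) else 0)).Local v × (cmDatum L 1 (Matrix.of fun i j : Fin 1 => if i.val + j.val + 1 = 1 then (1 : L) else 0)).Local v))),
      ∃ (xm : ↥(unitaryGroupOfForm (galAdicCompletionMap (L := L) (IsCMField.complexConj L) hw) (placeForm (Matrix.of fun i j : Fin 2 => if i.val + j.val + 1 = 2 then (1 : L) else 0) w.1)))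
        (x : ℕ → ℕ → ↥(unitaryGroupOfForm (galAdicCompletionMap (L := L) (IsCMField.complexConj L) hw) (placeForm (Matrix.of fun i j : Fin 2 => if i.val + j.val + 1 = 2 then (1 : L) else 0) w.1))),
        (xm : GL (Fin 2) (w.1.adicCompletion L)) ∈ glInt 2 (w.1.adicCompletion L) ∧ (∀ i b, (x i b : GL (Fin 2) (w.1.adicCompletion L)) ∈ glInt 2 (w.1.adicCompletion L)) ∧
        (((xm : ↥(unitaryGroupOfForm (galAdicCompletionMap (L := L) (IsCMField.complexConj L) hw) (placeForm (Matrix.of fun i j : Fin 2 => if i.val + j.val + 1 = 2 then (1 : L) else 0) w.1))) : GL (Fin 2) (w.1.adicCompletion L)) : Matrix (Fin 2) (Fin 2) (w.1.adicCompletion L)) =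
          ((((P⁻¹).val * ((t : ((cmDatum L 2 (Matrix.of fun i j : Fin 2 => if i.val + j.val + 1 = 2 then (1 : L) else 0)).Local v × (cmDatum L 1 (Matrix.of fun i j : Fin 1 => if i.val + j.val + 1 = 1 then (1 : L) else 0)).Local v)).1.val.val : Matrix (Fin 2) (Fin 2) (LocalRing L v)) * P.val) 1 1) w) • (1 : Matrix (Fin 2) (Fin 2) (w.1.adicCompletion L)) ∧
        ∀ i b, Odd i → (((x i b : ↥(unitaryGroupOfForm (galAdicCompletionMap (L := L) (IsCMField.complexConj L) hw) (placeForm (Matrix.of fun i j : Fin 2 => if i.val + j.val + 1 = 2 then (1 : L) else 0) w.1))) : GL (Fin 2) (w.1.adicCompletion L)) : Matrix (Fin 2) (Fin 2) (w.1.adicCompletion L)) =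
          ((((P⁻¹).val * ((t : ((cmDatum L 2 (Matrix.of fun i j : Fin 2 => if i.val + j.val + 1 = 2 then (1 : L) else 0)).Local v × (cmDatum L 1 (Matrix.of fun i j : Fin 1 => if i.val + j.val + 1 = 1 then (1 : L) else 0)).Local v)).1.val.val : Matrix (Fin 2) (Fin 2) (LocalRing L v)) * P.val) 1 1) w) • ((1 : Matrix (Fin 2) (Fin 2) (w.1.adicCompletion L)) + (ϖu : w.1.adicCompletion L) ^ i • !![0, ((η : 𝒪[w.1.adicCompletion L]) : w.1.adicCompletion L) ^ b; 0, 0]) := fun t => by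
    obtain ⟨xm, x, hxmI, hxI, hxm, -, hx, -⟩ := exists_unitary_signedNormalForm_elements (galAdicCompletionMap (L := L) (IsCMField.complexConj L) hw) (placeForm (Matrix.of fun i j : Fin 2 => if i.val + j.val + 1 = 2 then (1 : L) else 0) w.1) hJ (hcw t) (hcv t) hσϖ' hϖO hσηL η.2
    exact ⟨xm, x, hxmI, hxI, hxm, hx⟩
  choose xm xE hxmI hxEI hxm hxE using hexE
  have hexV : ∀ t : ↥(Subgroup.centralizer ({γH} : Set ((cmDatum L 2 (Matrix.of fun i j : Fin 2 => if i.val + j.val + 1 = 2 then (1 : L) else 0)).Local v × (cmDatum L 1 (Matrix.of fun i j : Fin 1 => if i.val + j.val + 1 = 1 then (1 : L) else 0)).Local v))),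
      ∃ (xm' : ↥(unitaryGroupOfForm (galAdicCompletionMap (L := L) (IsCMField.complexConj L) hw) (placeForm (Matrix.of fun i j : Fin 2 => if i.val + j.val + 1 = 2 then (1 : L) else 0) w.1)))
        (x : ℕ → ℕ → ↥(unitaryGroupOfForm (galAdicCompletionMap (L := L) (IsCMField.complexConj L) hw) (placeForm (Matrix.of fun i j : Fin 2 => if i.val + j.val + 1 = 2 then (1 : L) else 0) w.1))),
        (xm' : GL (Fin 2) (w.1.adicCompletion L)) ∈ (glInt 2 (w.1.adicCompletion L)).map (MulAut.conj (glDiagonal 2 (w.1.adicCompletion L) ![1, ϖu])).toMonoidHom ∧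
        (∀ i b, (x i b : GL (Fin 2) (w.1.adicCompletion L)) ∈ (glInt 2 (w.1.adicCompletion L)).map (MulAut.conj (glDiagonal 2 (w.1.adicCompletion L) ![1, ϖu])).toMonoidHom) ∧
        (((xm' : ↥(unitaryGroupOfForm (galAdicCompletionMap (L := L) (IsCMField.complexConj L) hw) (placeForm (Matrix.of fun i j : Fin 2 => if i.val + j.val + 1 = 2 then (1 : L) else 0) w.1))) : GL (Fin 2) (w.1.adicCompletion L)) : Matrix (Fin 2) (Fin 2) (w.1.adicCompletion L)) =
          ((((P⁻¹).val * ((t : ((cmDatum L 2 (Matrix.of fun i j : Fin 2 => if i.val + j.val + 1 = 2 then (1 : L) else 0)).Local v × (cmDatum L 1 (Matrix.of fun i j : Fin 1 => if i.val + j.val + 1 = 1 then (1 : L) else 0)).Local v)).1.val.val : Matrix (Fin 2) (Fin 2) (LocalRing L v)) * P.val) 1 1) w) • (1 : Matrix (Fin 2) (Fin 2) (w.1.adicCompletion L)) ∧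
        ∀ i b, Even i → (((x i b : ↥(unitaryGroupOfForm (galAdicCompletionMap (L := L) (IsCMField.complexConj L) hw) (placeForm (Matrix.of fun i j : Fin 2 => if i.val + j.val + 1 = 2 then (1 : L) else 0) w.1))) : GL (Fin 2) (w.1.adicCompletion L)) : Matrix (Fin 2) (Fin 2) (w.1.adicCompletion L)) =
          ((((P⁻¹).val * ((t : ((cmDatum L 2 (Matrix.of fun i j : Fin 2 => if i.val + j.val + 1 = 2 then (1 : L) else 0)).Local v × (cmDatum L 1 (Matrix.of fun i j : Fin 1 => if i.val + j.val + 1 = 1 then (1 : L) else 0)).Local v)).1.val.val : Matrix (Fin 2) (Fin 2) (LocalRing L v)) * P.val) 1 1) w) • ((1 : Matrix (Fin 2) (Fin 2) (w.1.adicCompletion L)) + (ϖu : w.1.adicCompletion L) ^ i •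
            ((((glDiagonal 2 (w.1.adicCompletion L) ![1, ϖu]) : GL (Fin 2) (w.1.adicCompletion L)) : Matrix (Fin 2) (Fin 2) (w.1.adicCompletion L)) * !![0, ((η : 𝒪[w.1.adicCompletion L]) : w.1.adicCompletion L) ^ b; 0, 0] * ((((glDiagonal 2 (w.1.adicCompletion L) ![1, ϖu]))⁻¹ : GL (Fin 2) (w.1.adicCompletion L)) : Matrix (Fin 2) (Fin 2) (w.1.adicCompletion L)))) := fun t => by
    obtain ⟨xm', x, hxm'I, hxI, hxm', -, hx, -⟩ := exists_conj_signedNormalForm_elements_modular (galAdicCompletionMap (L := L) (IsCMField.complexConj L) hw) (placeForm (Matrix.of fun i j : Fin 2 => if i.val + j.val + 1 = 2 then (1 : L) else 0) w.1) hJ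
      (glDiagonal 2 (w.1.adicCompletion L) ![1, ϖu]) hD (hcw t) (hcv t) hσϖ' hϖO hσηL η.2
    exact ⟨xm', x, hxm'I, hxI, hxm', hx⟩
  choose xm' xV hxm'I hxVI hxm' hxV using hexV
  obtain ⟨XE, hXE⟩ : ∃ XE : ↥(Subgroup.centralizer ({γH} : Set ((cmDatum L 2 (Matrix.of fun i j : Fin 2 => if i.val + j.val + 1 = 2 then (1 : L) else 0)).Local v × (cmDatum L 1 (Matrix.of fun i j : Fin 1 => if i.val + j.val + 1 = 1 then (1 : L) else 0)).Local v))) → ℕ → ℕ →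
      ↥(unitaryGroupOfForm (galAdicCompletionMap (L := L) (IsCMField.complexConj L) hw) (placeForm (Matrix.of fun i j : Fin 2 => if i.val + j.val + 1 = 2 then (1 : L) else 0) w.1)), ∀ t i b, XE t i b = if Odd i then xE t i b else xm t :=
    ⟨_, fun _ _ _ => rfl⟩
  obtain ⟨XV, hXV⟩ : ∃ XV : ↥(Subgroup.centralizer ({γH} : Set ((cmDatum L 2 (Matrix.of fun i j : Fin 2 => if i.val + j.val + 1 = 2 then (1 : L) else 0)).Local v × (cmDatum L 1 (Matrix.of fun i j : Fin 1 => if i.val + j.val + 1 = 1 then (1 : L) else 0)).Local v))) → ℕ → ℕ →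
      ↥(unitaryGroupOfForm (galAdicCompletionMap (L := L) (IsCMField.complexConj L) hw) (placeForm (Matrix.of fun i j : Fin 2 => if i.val + j.val + 1 = 2 then (1 : L) else 0) w.1)), ∀ t i b, XV t i b = if Even i then xV t i b else xm' t :=
    ⟨_, fun _ _ _ => rfl⟩
  have hXE' : ∀ t i b, Odd i → (((XE t i b : ↥(unitaryGroupOfForm (galAdicCompletionMap (L := L) (IsCMField.complexConj L) hw) (placeForm (Matrix.of fun i j : Fin 2 => if i.val + j.val + 1 = 2 then (1 : L) else 0) w.1))) : GL (Fin 2) (w.1.adicCompletion L)) : Matrix (Fin 2) (Fin 2) (w.1.adicCompletion L)) =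
      ((((P⁻¹).val * ((t : ((cmDatum L 2 (Matrix.of fun i j : Fin 2 => if i.val + j.val + 1 = 2 then (1 : L) else 0)).Local v × (cmDatum L 1 (Matrix.of fun i j : Fin 1 => if i.val + j.val + 1 = 1 then (1 : L) else 0)).Local v)).1.val.val : Matrix (Fin 2) (Fin 2) (LocalRing L v)) * P.val) 1 1) w) • ((1 : Matrix (Fin 2) (Fin 2) (w.1.adicCompletion L)) + (ϖu : w.1.adicCompletion L) ^ i • !![0, ((η : 𝒪[w.1.adicCompletion L]) : w.1.adicCompletion L) ^ b; 0, 0]) :=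
    fun t i b hi => by rw [hXE, if_pos hi]; exact hxE t i b hi
  have hXV' : ∀ t i b, Even i → (((XV t i b : ↥(unitaryGroupOfForm (galAdicCompletionMap (L := L) (IsCMField.complexConj L) hw) (placeForm (Matrix.of fun i j : Fin 2 => if i.val + j.val + 1 = 2 then (1 : L) else 0) w.1))) : GL (Fin 2) (w.1.adicCompletion L)) : Matrix (Fin 2) (Fin 2) (w.1.adicCompletion L)) =
      ((((P⁻¹).val * ((t : ((cmDatum L 2 (Matrix.of fun i j : Fin 2 => if i.val + j.val + 1 = 2 then (1 : L) else 0)).Local v × (cmDatum L 1 (Matrix.of fun i j : Fin 1 => if i.val + j.val + 1 = 1 then (1 : L) else 0)).Local v)).1.val.val : Matrix (Fin 2) (Fin 2) (LocalRing L v)) * P.val) 1 1) w) • ((1 : Matrix (Fin 2) (Fin 2) (w.1.adicCompletion L)) + (ϖu : w.1.adicCompletion L) ^ i •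
        ((((glDiagonal 2 (w.1.adicCompletion L) ![1, ϖu]) : GL (Fin 2) (w.1.adicCompletion L)) : Matrix (Fin 2) (Fin 2) (w.1.adicCompletion L)) * !![0, ((η : 𝒪[w.1.adicCompletion L]) : w.1.adicCompletion L) ^ b; 0, 0] * ((((glDiagonal 2 (w.1.adicCompletion L) ![1, ϖu]))⁻¹ : GL (Fin 2) (w.1.adicCompletion L)) : Matrix (Fin 2) (Fin 2) (w.1.adicCompletion L)))) :=
    fun t i b hi => by rw [hXV, if_pos hi]; exact hxV t i b hi
  have hXEI : ∀ t i b, ((XE t i b : ↥(unitaryGroupOfForm (galAdicCompletionMap (L := L) (IsCMField.complexConj L) hw) (placeForm (Matrix.of fun i j : Fin 2 => if i.val + j.val + 1 = 2 then (1 : L) else 0) w.1))) : GL (Fin 2) (w.1.adicCompletion L)) ∈ glInt 2 (w.1.adicCompletion L) := fun t i b => by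
    rw [hXE]
    split_ifs
    · exact hxEI t i b
    · exact hxmI t
  have hXVI : ∀ t i b, ((XV t i b : ↥(unitaryGroupOfForm (galAdicCompletionMap (L := L) (IsCMField.complexConj L) hw) (placeForm (Matrix.of fun i j : Fin 2 => if i.val + j.val + 1 = 2 then (1 : L) else 0) w.1))) : GL (Fin 2) (w.1.adicCompletion L)) ∈
      (glInt 2 (w.1.adicCompletion L)).map (MulAut.conj (glDiagonal 2 (w.1.adicCompletion L) ![1, ϖu])).toMonoidHom := fun t i b => by
    rw [hXV]
    split_ifs
    · exact hxVI t i b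
    · exact hxm'I t
  -- the point `t = γ_H ∈ Z(γ_H)` and its depth `N(t) = N`
  have hNt : (-WithZero.log (Valued.v ((((P⁻¹).val * (((⟨γH, hZ⟩ : ↥(Subgroup.centralizer ({γH} : Set ((cmDatum L 2 (Matrix.of fun i j : Fin 2 => if i.val + j.val + 1 = 2 then (1 : L) else 0)).Local v × (cmDatum L 1 (Matrix.of fun i j : Fin 1 => if i.val + j.val + 1 = 1 then (1 : L) else 0)).Local v)))) : ((cmDatum L 2 (Matrix.of fun i j : Fin 2 => if i.val + j.val + 1 = 2 then (1 : L) else 0)).Local v × (cmDatum L 1 (Matrix.of fun i j : Fin 1 => if i.val + j.val + 1 = 1 then (1 : L) else 0)).Local v)).1.val.val : Matrix (Fin 2) (Fin 2) (LocalRing L v)) * P.val) 0 0 - ((P⁻¹).val * (((⟨γH, hZ⟩ : ↥(Subgroup.centralizer ({γH} : Set ((cmDatum L 2 (Matrix.of fun i j : Fin 2 => if i.val + j.val + 1 = 2 then (1 : L) else 0)).Local v × (cmDatum L 1 (Matrix.of fun i j : Fin 1 => if i.val + j.val + 1 = 1 then (1 : L) else 0)).Local v)))) : ((cmDatum L 2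 (Matrix.of fun i j : Fin 2 => if i.val + j.val + 1 = 2 then (1 : L) else 0)).Local v × (cmDatum L 1 (Matrix.of fun i j : Fin 1 => if i.val + j.val + 1 = 1 then (1 : L) else 0)).Local v)).1.val.val : Matrix (Fin 2) (Fin 2) (LocalRing L v)) * P.val) 1 1) w))).toNat = N := by
    rw [hτ 0, hτ 1, Pi.sub_apply, hu0, hu1w, hN, WithZero.log_exp, neg_neg, Int.toNat_natCast]
  have hregt : IsRegularElt (((⟨γH, hZ⟩ : ↥(Subgroup.centralizer ({γH} : Set ((cmDatum L 2 (Matrix.of fun i j : Fin 2 => if i.val + j.val + 1 = 2 then (1 : L) else 0)).Local v × (cmDatum L 1 (Matrix.of fun i j : Fin 1 => if i.val + j.val + 1 = 1 then (1 : L) else 0)).Local v)))) : ((cmDatum L 2 (Matrix.of fun i j : Fin 2 => if i.val + j.val + 1 = 2 then (1 : L) else 0)).Local v × (cmDatum L 1 (Matrix.of fun i j : Fin 1 => if i.val + j.val + 1 = 1 then (1 : L) else 0)).Local v)).1.val : GL (Fin 2) (LocalRing L v)) := ht₀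
  -- §e the EDGE and VERTEX expansions of the two pieces at `t` and at `e t` (★ T6-1r pair sums, `m = 1`)
  have hO0 := integral_conj_add_integral_conj_partner_eq_ramified_selfDual L v w hw νH γH P u ht₀ hP' hu1 he h2v ϖu hϖ' hσϖ' σO hσO' hσσ hres uu hvu hσu hηu' hηu hση hη
    E₂ hE₂' e he2 hconjE (K₂ 0) hdict0 (hK₂o 0) (hK₂c 0) (φp 0) (hφs 0) (hφK 0) Q hQ hQh hh hσh rQ hr hsq 1 le_rfl
    ((localCongruenceSubgroup 2 L w.1 1).subgroupOf _) hKm0 hφm0 xm hxm XE hXE' ⟨γH, hZ⟩ hregt (by rw [hNt]; exact hN1)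
  have hO1 := integral_conj_add_integral_conj_partner_eq_ramified_modular L v w hw νH γH P u ht₀ hP' hu1 he h2v ϖu hϖ' hσϖ' σO hσO' hσσ hres uu hvu hσu hηu' hηu hση hη
    (glDiagonal 2 (w.1.adicCompletion L) ![1, ϖu]) hD E₂ hE₂' e he2 hconjE (K₂ 1) hdict1 (hK₂o 1) (hK₂c 1) (φp 1) (hφs 1) (hφK 1) Q hQ hQh hh hσh rQ hr hsq 1 le_rfl
    (((localCongruenceSubgroup 2 L w.1 1).map (MulAut.conj (glDiagonal 2 (w.1.adicCompletion L) ![1, ϖu])).toMonoidHom).subgroupOf _) hKm1 hφm1 xm' hxm' XV hXV' ⟨γH, hZ⟩ hregt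
    (by rw [hNt]; exact hN1)
  rw [hNt] at hO0 hO1
  -- the pieces take the value `1` on every normal-form element
  have hv0m : φp 0 (E₂.symm (xm ⟨γH, hZ⟩), γH.2) = 1 := hval0 _ _ (hxmI _)
  have hv0 : ∀ i b, φp 0 (E₂.symm (XE ⟨γH, hZ⟩ i b), γH.2) = 1 := fun i b => hval0 _ _ (hXEI _ i b)
  have hv1m : φp 1 (E₂.symm (xm' ⟨γH, hZ⟩), γH.2) = 1 := hval1 _ _ (hxm'I _)
  have hv1 : ∀ i b, φp 1 (E₂.symm (XV ⟨γH, hZ⟩ i b), γH.2) = 1 := fun i b => hval1 _ _ (hXVI _ i b)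
  simp only [hv0m, hv0, hv1m, hv1, nsmul_eq_mul, mul_one, Complex.real_smul] at hO0 hO1
  -- the stable orbital integrals of the two pieces: ★ T6-1u′ adapter (the stable class of `t` is `{⟦t⟧, ⟦e t⟧}`)
  have hA : ∀ ε, stableOrbitalIntegralRel (IsLocalStablyConjH L v) mH (φp ε) γH =
      (∫ y, φp ε (y * γH * y⁻¹) ∂νH) + ∫ y, φp ε (y * e γH * y⁻¹) ∂νH := fun ε =>
    stableOrbitalIntegralRel_eq_integral_add_integral_of_frame L v hv νH mH (IsLocalGRegular L v) hReg hconj hstab hmH (φp ε) (hφsm ε) γH P u ht₀ hP' hu1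
      ⟨γH, hZ⟩ hreg (e γH) (hest ⟨γH, hZ⟩ hregt).1 (hest ⟨γH, hZ⟩ hregt).2
  refine ⟨?_, ?_⟩
  · rw [← hφp 0, hA 0]; exact hO0
  · rw [← hφp 1, hA 1]; exact hO1

/-! ## §2 STUB B′ of the v2 skeleton, with content -/

set_option maxHeartbeats 1600000 in
/-- **STUB B′ `stub_typeOne_HSideBasis_ram` OF THE v2 P-1-ram SKELETON (e79877dd9dcb92c5 :141), TOKEN FOR TOKEN, WITH THE WITNESSES OF CONTENT** `r := 2`,
`ψ := ![1_{K⁰ × U₁}, 1_{K♯ × U₁}]` (the vertex pair of ★ `exists_vertexCover_of_ramified`), `Y s N := (ν_H(K₂ s × U₁)∕ν_H(K_H))·Y♮ s N` (§1).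
[cite: Rogawski1990, §4.9 Lemma 4.9.3 p. 56; §8.1 Prop. 8.1.1 p. 112] [cite: LabesseLanglands1979, §2 Lemma 2.1, §5] -/
theorem stableOrbitalIntegralRel_typeOne_HSideBasis_ramified
    (L : Type) [Field L] [NumberField L] [IsCMField L]
    {v : HeightOneSpectrum (𝓞 ↥(maximalRealSubfield L))} (w : PlacesOver L v)
    (hw : IsCMField.complexConj L • w.1 = w.1) (he : v.asIdeal.ramificationIdx' w.1.asIdeal ≠ 1)
    (h2 : IsUnit (2 : 𝒪[(w.1.adicCompletion L)]))
    (ϖ : (w.1.adicCompletion L)) (hϖ : Valued.v ϖ = WithZero.exp (-1 : ℤ)) (hσϖ : galAdicCompletionMap (L := L) (IsCMField.complexConj L) hw ϖ = -ϖ)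
    [MeasurableSpace ((cmDatum L 2 (Matrix.of fun i j : Fin 2 => if i.val + j.val + 1 = 2 then (1 : L) else 0)).Local v × (cmDatum L 1 (Matrix.of fun i j : Fin 1 => if i.val + j.val + 1 = 1 then (1 : L) else 0)).Local v)] [BorelSpace ((cmDatum L 2 (Matrix.of fun i j : Fin 2 => if i.val + j.val + 1 = 2 then (1 : L) else 0)).Local v × (cmDatum L 1 (Matrix.of fun i j : Fin 1 => if i.val + j.val + 1 = 1 then (1 : L) else 0)).Local v)]
    [∀ a : ((cmDatum L 2 (Matrix.of fun i j : Fin 2 => if i.val + j.val + 1 = 2 then (1 : L) else 0)).Local v × (cmDatum L 1 (Matrix.of fun i j : Fin 1 => if i.val + j.val + 1 = 1 then (1 : L) else 0)).Local v), MeasurableSpace (((cmDatum L 2 (Matrix.of fun i j : Fin 2 => if i.val + j.val + 1 = 2 then (1 : L) else 0)).Local v × (cmDatum L 1 (Matrix.of fun i j : Fin 1 => if i.val + j.val + 1 = 1 then (1 : L) else 0)).Local v) ⧸ Subgroup.centralizer ({a} : Set ((cmDatum L 2 (Matrix.of fun i j : Fin 2 => if i.val + j.val + 1 = 2 then (1 :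 L) else 0)).Local v × (cmDatum L 1 (Matrix.of fun i j : Fin 1 => if i.val + j.val + 1 = 1 then (1 : L) else 0)).Local v)))]
    [∀ a : ((cmDatum L 2 (Matrix.of fun i j : Fin 2 => if i.val + j.val + 1 = 2 then (1 : L) else 0)).Local v × (cmDatum L 1 (Matrix.of fun i j : Fin 1 => if i.val + j.val + 1 = 1 then (1 : L) else 0)).Local v), BorelSpace (((cmDatum L 2 (Matrix.of fun i j : Fin 2 => if i.val + j.val + 1 = 2 then (1 : L) else 0)).Local v × (cmDatum L 1 (Matrix.of fun i j : Fin 1 => if i.val + j.val + 1 = 1 then (1 : L) else 0)).Local v) ⧸ Subgroup.centralizer ({a} : Set ((cmDatum L 2 (Matrix.of fun i j : Fin 2 => if i.val + j.val + 1 = 2 then (1 : L) else 0)).Local v × (cmDatum L 1 (Matrix.of fun i j : Fin 1 => if i.val + j.val + 1 = 1 then (1 : L) else 0)).Local v)))]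
    (νH : Measure ((cmDatum L 2 (Matrix.of fun i j : Fin 2 => if i.val + j.val + 1 = 2 then (1 : L) else 0)).Local v × (cmDatum L 1 (Matrix.of fun i j : Fin 1 => if i.val + j.val + 1 = 1 then (1 : L) else 0)).Local v)) [νH.IsHaarMeasure] [νH.IsMulRightInvariant]
    {mH : OrbitalMeasureFamily ((cmDatum L 2 (Matrix.of fun i j : Fin 2 => if i.val + j.val + 1 = 2 then (1 : L) else 0)).Local v × (cmDatum L 1 (Matrix.of fun i j : Fin 1 => if i.val + j.val + 1 = 1 then (1 : L) else 0)).Local v)} (hmH : mH.IsCanonical (IsLocalGRegular L v) νH) :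
    ∃ (r : ℕ) (ψ : Fin r → ((cmDatum L 2 (Matrix.of fun i j : Fin 2 => if i.val + j.val + 1 = 2 then (1 : L) else 0)).Local v × (cmDatum L 1 (Matrix.of fun i j : Fin 1 => if i.val + j.val + 1 = 1 then (1 : L) else 0)).Local v) → ℂ), (∀ s, IsLocSmooth (ψ s)) ∧
    ∃ Y : Fin r → ℕ → ℂ, ∃ V ∈ 𝓝 (1 : ((cmDatum L 2 (Matrix.of fun i j : Fin 2 => if i.val + j.val + 1 = 2 then (1 : L) else 0)).Local v × (cmDatum L 1 (Matrix.of fun i j : Fin 1 => if i.val + j.val + 1 = 1 then (1 : L) else 0)).Local v)),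
      ∀ γH ∈ V, IsLocalGRegular L v γH →
        (∃ x : (w.1.adicCompletion L), (((γH.1.val : GL (Fin 2) (UnitaryGroup.LocalRing L v)).val.map
          (Pi.evalRingHom (fun w' : PlacesOver L v => w'.1.adicCompletion L) w)).charpoly).IsRoot x) →
        ¬ (∃ (y : ((cmDatum L 2 (Matrix.of fun i j : Fin 2 => if i.val + j.val + 1 = 2 then (1 : L) else 0)).Local v × (cmDatum L 1 (Matrix.of fun i j : Fin 1 => if i.val + j.val + 1 = 1 then (1 : L) else 0)).Local v)) (d' : Fin 2 → (UnitaryGroup.LocalRing L v)ˣ),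
          glDiagonal 2 (UnitaryGroup.LocalRing L v) d' = ((y * γH * y⁻¹).1.val : GL (Fin 2) (UnitaryGroup.LocalRing L v))) →
        ∀ (α γ : (w.1.adicCompletion L)),
          ((((γH.1.val : GL (Fin 2) (UnitaryGroup.LocalRing L v)) : Matrix (Fin 2) (Fin 2) (UnitaryGroup.LocalRing L v)).charpoly).map (Pi.evalRingHom (fun w' : PlacesOver L v => w'.1.adicCompletion L) w)).IsRoot α →
          ((((γH.1.val : GL (Fin 2) (UnitaryGroup.LocalRing L v)) : Matrix (Fin 2) (Fin 2) (UnitaryGroup.LocalRing L v)).charpoly).map (Pi.evalRingHom (fun w' : PlacesOver L v => w'.1.adicCompletion L) w)).IsRoot γ →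
          α ≠ γ → ∀ N : ℕ, Valued.v (α - γ) = WithZero.exp (-(N : ℤ)) →
          ∀ s : Fin r, stableOrbitalIntegralRel (IsLocalStablyConjH L v) mH (ψ s) γH = ((νH.real (((cmLocalIntegralLevel L 2 (Matrix.of fun i j : Fin 2 => if i.val + j.val + 1 = 2 then (1 : L) else 0) v).prod (cmLocalIntegralLevel L 1 (Matrix.of fun i j : Fin 1 => if i.val + j.val + 1 = 1 then (1 : L) else 0) v) : Subgroup _) : Set _) : ℝ) : ℂ) * Y s N := by
  classical
  have h2v : Valued.v (2 : w.1.adicCompletion L) = 1 := (isUnit_two_integer_iff_valued_eq_one L w.1).1 h2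
  have hϖ0 : ϖ ≠ 0 := by
    intro h0
    have h : Valued.v ϖ = 0 := by rw [h0, map_zero]
    rw [hϖ] at h
    exact WithZero.coe_ne_zero h
  obtain ⟨ϖu, hϖu⟩ : ∃ ϖu : (w.1.adicCompletion L)ˣ, (ϖu : w.1.adicCompletion L) = ϖ := ⟨Units.mk0 ϖ hϖ0, rfl⟩
  have hϖ' : Valued.v (ϖu : w.1.adicCompletion L) = WithZero.exp (-1 : ℤ) := by rw [hϖu]; exact hϖ
  have hσϖ' : (galAdicCompletionMap (L := L) (IsCMField.complexConj L) hw) (ϖu : w.1.adicCompletion L) = -(ϖu : w.1.adicCompletion L) := by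
    rw [hϖu]; exact hσϖ
  -- the two vertex types (★ I-5a-ram) and the core
  obtain ⟨K₂, hK0, hd0, hd1', hK₂o, hK₂c, -⟩ := exists_vertexCover_of_ramified L v w hw he h2v ϖu hϖ' hσϖ'
  obtain ⟨V, hV, hcore⟩ := stableOrbitalIntegralRel_indicator_vertexTypes_ramified L w hw he h2 ϖu hϖ' hσϖ' νH hmH K₂ hd0 hd1' hK₂o hK₂c
  -- `K₁ = U(Φ₁)_v`, openness ∕ compactness of the two piece supports, positivity of `ν_H(K_H)`
  have hK1 : cmLocalIntegralLevel L 1 (Matrix.of fun i j : Fin 1 => if i.val + j.val + 1 = 1 then (1 : L) else 0) v = ⊤ :=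
    cmLocalIntegralLevel_one_eq_top_of_smul_eq L _ w hw (isUnit_placeForm_antidiagOne (E := L) 1 w.1)
  have hopen : ∀ ε, IsOpen (((K₂ ε).prod (⊤ : Subgroup ((cmDatum L 1 (Matrix.of fun i j : Fin 1 => if i.val + j.val + 1 = 1 then (1 : L) else 0)).Local v)) : Subgroup _) : Set ((cmDatum L 2 (Matrix.of fun i j : Fin 2 => if i.val + j.val + 1 = 2 then (1 : L) else 0)).Local v × (cmDatum L 1 (Matrix.of fun i j : Fin 1 => if i.val + j.val + 1 = 1 then (1 : L) else 0)).Local v)) := fun ε => by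
    rw [Subgroup.coe_prod, Subgroup.coe_top]; exact (hK₂o ε).prod isOpen_univ
  have hcpt : ∀ ε, IsCompact (((K₂ ε).prod (⊤ : Subgroup ((cmDatum L 1 (Matrix.of fun i j : Fin 1 => if i.val + j.val + 1 = 1 then (1 : L) else 0)).Local v)) : Subgroup _) : Set ((cmDatum L 2 (Matrix.of fun i j : Fin 2 => if i.val + j.val + 1 = 2 then (1 : L) else 0)).Local v × (cmDatum L 1 (Matrix.of fun i j : Fin 1 => if i.val + j.val + 1 = 1 then (1 : L) else 0)).Local v)) := fun ε => by
    have h1 := (isCompact_isOpen_cmLocalIntegralLevel L 1 (Matrix.of fun i j : Fin 1 => if i.val + j.val + 1 = 1 then (1 : L) else 0) v).1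
    rw [hK1, Subgroup.coe_top] at h1
    rw [Subgroup.coe_prod, Subgroup.coe_top]; exact (hK₂c ε).prod h1
  have hKpos : ((νH.real (((cmLocalIntegralLevel L 2 (Matrix.of fun i j : Fin 2 => if i.val + j.val + 1 = 2 then (1 : L) else 0) v).prod (cmLocalIntegralLevel L 1 (Matrix.of fun i j : Fin 1 => if i.val + j.val + 1 = 1 then (1 : L) else 0) v) : Subgroup _) : Set ((cmDatum L 2 (Matrix.of fun i j : Fin 2 => if i.val + j.val + 1 = 2 then (1 : L) else 0)).Local v × (cmDatum L 1 (Matrix.of fun i j : Fin 1 => if i.val + j.val + 1 = 1 then (1 : L) else 0)).Local v)) : ℝ) : ℂ) ≠ 0 := by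
    have hK2 := isCompact_isOpen_cmLocalIntegralLevel L 2 (Matrix.of fun i j : Fin 2 => if i.val + j.val + 1 = 2 then (1 : L) else 0) v
    have hK1' := isCompact_isOpen_cmLocalIntegralLevel L 1 (Matrix.of fun i j : Fin 1 => if i.val + j.val + 1 = 1 then (1 : L) else 0) v
    refine Complex.ofReal_ne_zero.2 ?_
    rw [measureReal_def]
    exact (ENNReal.toReal_pos ((hK2.2.prod hK1'.2).measure_pos νH ⟨(1, 1), Subgroup.one_mem _, Subgroup.one_mem _⟩).ne'
      (hK2.1.prod hK1'.1).measure_lt_top.ne).ne'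
  refine ⟨2, ![(((K₂ 0).prod (⊤ : Subgroup ((cmDatum L 1 (Matrix.of fun i j : Fin 1 => if i.val + j.val + 1 = 1 then (1 : L) else 0)).Local v)) : Subgroup _) : Set ((cmDatum L 2 (Matrix.of fun i j : Fin 2 => if i.val + j.val + 1 = 2 then (1 : L) else 0)).Local v × (cmDatum L 1 (Matrix.of fun i j : Fin 1 => if i.val + j.val + 1 = 1 then (1 : L) else 0)).Local v)).indicator fun _ => (1 : ℂ), (((K₂ 1).prod (⊤ : Subgroup ((cmDatum L 1 (Matrix.of fun i j : Fin 1 => if i.val + j.val + 1 = 1 then (1 : L) else 0)).Local v)) : Subgroup _) : Set ((cmDatum L 2 (Matrix.of fun i j : Fin 2 => if i.val + j.val + 1 = 2 then (1 : L) else 0)).Local v × (cmDatum L 1 (Matrix.of fun i j : Fin 1 => if i.val + j.val + 1 = 1 then (1 : L) else 0)).Local v)).indicator fun _ => (1 : ℂ)], ?_,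
    ![fun N => ((νH.real (((K₂ 0).prod (⊤ : Subgroup ((cmDatum L 1 (Matrix.of fun i j : Fin 1 => if i.val + j.val + 1 = 1 then (1 : L) else 0)).Local v)) : Subgroup _) : Set ((cmDatum L 2 (Matrix.of fun i j : Fin 2 => if i.val + j.val + 1 = 2 then (1 : L) else 0)).Local v × (cmDatum L 1 (Matrix.of fun i j : Fin 1 => if i.val + j.val + 1 = 1 then (1 : L) else 0)).Local v)) : ℝ) : ℂ) / ((νH.real (((cmLocalIntegralLevel L 2 (Matrix.of fun i j : Fin 2 => if i.val + j.val + 1 = 2 then (1 : L) else 0) v).prod (cmLocalIntegralLevel L 1 (Matrix.of fun i j : Fin 1 => if i.val + j.val + 1 = 1 then (1 : L) else 0) v) : Subgroup _) : Set ((cmDatum L 2 (Matrix.of fun i j : Fin 2 => if i.val + j.val + 1 = 2 then (1 : L) else 0)).Local v × (cmDatum L 1 (Matrix.of fun i j : Fin 1 => if i.val + j.val + 1 = 1 then (1 : L) else 0)).Local v)) : ℝ) : ℂ) *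
          (((((2 * ∑ j ∈ (Finset.range (N + 1)).filter (fun j => j % 2 = 0 ∧ j + 1 ≤ N), (if j = 0 then 1 else 2 * (Nat.card (𝓞 ↥(maximalRealSubfield L) ⧸ v.asIdeal)) ^ (j / 2)) : ℕ)) : ℂ) +
            ∑ i ∈ Finset.range 1, (((if i ≤ N ∧ (N - i) % 2 = 0 then (if N - i = 0 then 1 else 2 * (Nat.card (𝓞 ↥(maximalRealSubfield L) ⧸ v.asIdeal)) ^ ((N - i) / 2)) else 0 : ℕ)) : ℂ) * (1 + 1))),
      fun N => ((νH.real (((K₂ 1).prod (⊤ : Subgroup ((cmDatum L 1 (Matrix.of fun i j : Fin 1 => if i.val + j.val + 1 = 1 then (1 : L) else 0)).Local v)) : Subgroup _) : Set ((cmDatum L 2 (Matrix.of fun i j : Fin 2 => if i.val + j.val + 1 = 2 then (1 : L) else 0)).Local v × (cmDatum L 1 (Matrix.of fun i j : Fin 1 => if i.val + j.val + 1 = 1 then (1 : L) else 0)).Local v)) : ℝ) : ℂ) / ((νH.real (((cmLocalIntegralLevel L 2 (Matrix.of fun i j : Fin 2 => if i.val + j.val + 1 = 2 then (1 : L) else 0)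 v).prod (cmLocalIntegralLevel L 1 (Matrix.of fun i j : Fin 1 => if i.val + j.val + 1 = 1 then (1 : L) else 0) v) : Subgroup _) : Set ((cmDatum L 2 (Matrix.of fun i j : Fin 2 => if i.val + j.val + 1 = 2 then (1 : L) else 0)).Local v × (cmDatum L 1 (Matrix.of fun i j : Fin 1 => if i.val + j.val + 1 = 1 then (1 : L) else 0)).Local v)) : ℝ) : ℂ) *
          (((((2 * ∑ j ∈ (Finset.range (N + 1)).filter (fun j => j % 2 = 1 ∧ j + 1 ≤ N), (if j = 0 then 1 else 2 * (Nat.card (𝓞 ↥(maximalRealSubfield L) ⧸ v.asIdeal)) ^ (j / 2)) : ℕ)) : ℂ) +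
            ∑ i ∈ Finset.range 1, (((if i ≤ N ∧ (N - i) % 2 = 1 then (if N - i = 0 then 1 else 2 * (Nat.card (𝓞 ↥(maximalRealSubfield L) ⧸ v.asIdeal)) ^ ((N - i) / 2)) else 0 : ℕ)) : ℂ) * (1 + 1)))], V, hV, ?_⟩
  · intro s
    fin_cases s
    · exact isLocSmooth_indicator_subgroup _ (hopen 0) (hcpt 0)
    · exact isLocSmooth_indicator_subgroup _ (hopen 1) (hcpt 1)
  · intro γH hγ hreg hsplit hell α γ hα hγr hαγ N hN s
    obtain ⟨h0, h1⟩ := hcore γH hγ hreg hsplit hell α γ hα hγr hαγ N hN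
    fin_cases s
    · simp only [Fin.zero_eta, Matrix.cons_val_zero]
      rw [h0, ← mul_assoc, mul_div_cancel₀ _ hKpos]
    · simp only [Fin.mk_one, Matrix.cons_val_one, Matrix.cons_val_zero]
      rw [h1, ← mul_assoc, mul_div_cancel₀ _ hKpos]

end Literature.NumberTheory.Rogawski1990

end
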